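import Summits.HubbardSuperconductivity.HubbardSuperconductivity.Theorems.BalabanIRBirComplexStableXYRHessianOrigin
import Mathlib.Analysis.SpecialFunctions.Trigonometric.Deriv
import Mathlib.Analysis.Calculus.LocalExtr.Basic
import HarnessLib

/-!
# Crux `BirComplexStableXY` (stmt-HubbardSuperconductivity-2080), negative lane: the FIRST-ORDER CONDITION at the
# constants — admissible tables have REAL first moments, so no admissible holomorphic family of tables moves the
# linear Berry coefficient

Support file (prover seat 3, route BalabanIR, session 33) for the HELD rev-0 engine record
`…Theses.BalabanIR.BirComplexStableXY` (and equally for the restated engine `BirComplexStableXYR`, stmt-14845,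
whose hypotheses (N), (C) are the same).  Vocabulary `Table`, `genF`, `sinTab`, `temporalSinTab`, `vx`, `dfreq` of
`Theorems.BirComplexStableXY.Negative.WitnessTable`; the ray lemmas `cvxr_re_genF_ray`, `cvxr_sum_re_eq_zero` of
`…BirComplexStableXYRHessianOrigin` (which proves the SECOND-order condition and remarks that it needs no
first-order input — this file supplies the first-order condition itself, which is what constrains witness DESIGN).

For a finite Fourier table `c` with (N) `Σ_n c_n = 0` and (C) `c₀ ΣΣ(1 - cos(φ_w - φ_w')) ≤ Re F_c(φ)` for all real
`φ` (ANY real `c₀`, no sign needed), the function `g(t) = Re F_c(tv) - c₀ ΣΣ(1 - cos(t(v_w - v_w')))` is `≥ 0 = g(0)`,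
so Fermat's theorem gives `g'(0) = 0`, i.e.

* `birMom_sum_im_mul_frq_eq_zero` : `Σ_n Im(c_n) (n·v) = 0` for every direction `v`;
* `birMom_moment_im_eq_zero`     : every first moment `Σ_n n_w c_n` (`w ∈ W_r`) is REAL.

Consequently (`birMom_dir_moment_eq_zero`, registered one-line form `birMom_moment_eq_zero_of_isOpen`) if an AFFINE family `c + ζ • d` satisfies (N) and (C) for all `ζ`
in an OPEN nonempty set of COMPLEX parameters, the direction `d` has ALL first moments zero; in particular
(`birMom_moment_temporalSinTab`, `birMom_not_admissible_complex_tilt`) the time-odd tilt direction `temporalSinTab`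
(`Σ_{4 temporal edges} sin ∂_τφ`, first moment `-i` at the vertex `(0,0,1)`) is admissible on NO open set of complex
coefficients, whatever the base table.

WHY IT MATTERS (analysis note `NoCheapHeart-2080-s33.md` on stmt-2080): every heart of the negative lane
(`WitnessZeroExists`, `StiffTwoLevelStructure`, `StiffModulusCrossing`, `CubicModulusCrossing`) locates an exact zero of
`Z_M(ζ)` inside a COMPLEX ball of admissible tables along a holomorphic family `ζ ↦ c(ζ)`.  In the frozen-slice
picture the dominant charge sector is `q⋆ = K′·(linear Berry coefficient) + O(1)`, and the linear Berry coefficient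
is a fixed real-linear combination of the first moments `Σ_n n_w c_n(ζ)`.  By this file those moments are real on the
open parameter set, hence (holomorphic and real ⇒) CONSTANT: along every admissible holomorphic family the
leading-order band centre cannot move, so any dominance switch / modulus crossing is an `O(1)`-sector effect and
needs the sector profile to precision ONE sector spacing `O(1/(K′a))` — the quantitative core identified by prover
c4 (`Cruxes/BirGappedPhaseReduction/ANALYSIS-prover-c4.md`, O1–O2) is therefore intrinsic to the holomorphic method,
not an artefact of the chosen families.  [folklore]

No definitions; fully proved, standard axioms.
-/

set_option linter.dupNamespace false

noncomputable section

namespace Summit.HubbardSuperconductivity.HubbardSuperconductivity.Theorems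

open scoped BigOperators
open Summit.HubbardSuperconductivity.BirComplexStableXYNegative

section AdmissibleMoments

variable {r : ℕ}

/-! ## Derivatives along a ray through the constants -/

/-- `d/dt Re F_c(tv) |_{t=0} = -Σ_n Im(c_n) (n·v)`. [folklore] -/
theorem birMom_hasDerivAt_re_genF_ray (c : Table r) (v : W r → ℝ) :
    HasDerivAt (fun t : ℝ => (genF c (fun w => t * v w)).re)
      (-∑ n ∈ c.support, (c n).im * ∑ w, (n w : ℝ) * v w) 0 := by
  have hfun : (fun t : ℝ => (genF c (fun w => t * v w)).re) = fun t =>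
      ∑ n ∈ c.support, ((c n).re * Real.cos (t * ∑ w, (n w : ℝ) * v w) -
        (c n).im * Real.sin (t * ∑ w, (n w : ℝ) * v w)) := by
    funext t
    exact cvxr_re_genF_ray c v t
  rw [hfun]
  have hterm : ∀ n ∈ c.support, HasDerivAt (fun t : ℝ =>
      (c n).re * Real.cos (t * ∑ w, (n w : ℝ) * v w) -
        (c n).im * Real.sin (t * ∑ w, (n w : ℝ) * v w))
      (-((c n).im * ∑ w, (n w : ℝ) * v w)) 0 := by
    intro n _
    have hlin : HasDerivAt (fun t : ℝ => t * ∑ w, (n w : ℝ) * v w) (∑ w, (n w : ℝ) * v w) 0 :=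
      hasDerivAt_mul_const _
    have h := ((hlin.cos).const_mul (c n).re).fun_sub ((hlin.sin).const_mul (c n).im)
    exact h.congr_deriv (by simp)
  have hsum := HasDerivAt.fun_sum hterm
  exact hsum.congr_deriv (Finset.sum_neg_distrib _)

/-- The coercivity comparison term `c₀ ΣΣ(1 - cos(t v_w - t v_w'))` is stationary at `t = 0`. [folklore] -/
theorem birMom_hasDerivAt_cosPart (c₀ : ℝ) (v : W r → ℝ) :
    HasDerivAt (fun t : ℝ => c₀ * ∑ w, ∑ w', (1 - Real.cos (t * v w - t * v w'))) 0 0 := by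
  have hterm : ∀ w w' : W r,
      HasDerivAt (fun t : ℝ => 1 - Real.cos (t * v w - t * v w')) 0 0 := by
    intro w w'
    have hlin : HasDerivAt (fun t : ℝ => t * v w - t * v w') (v w - v w') 0 :=
      (hasDerivAt_mul_const (v w)).fun_sub (hasDerivAt_mul_const (v w'))
    have h := (hasDerivAt_const (0:ℝ) (1:ℝ)).fun_sub hlin.cos
    exact h.congr_deriv (by simp)
  have hsum : HasDerivAt (fun t : ℝ => ∑ w, ∑ w', (1 - Real.cos (t * v w - t * v w')))
      (∑ _w : W r, ∑ _w' : W r, (0:ℝ)) 0 :=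
    HasDerivAt.fun_sum fun w _ => HasDerivAt.fun_sum fun w' _ => hterm w w'
  simpa using hsum.const_mul c₀

/-! ## The first-order condition -/

/-- **First-order condition at the constants.**  If a table satisfies (N) `Σ_n c_n = 0` and the coercivity
comparison (C) `c₀ ΣΣ(1 - cos(φ_w - φ_w')) ≤ Re F_c(φ)` for all real `φ` (any real `c₀`), then for every direction
`v`, `Σ_n Im(c_n) (n·v) = 0`: the odd (sine) part of `Re F_c` has no linear term.  (Fermat: `t ↦ Re F_c(tv) -
c₀ΣΣ(1 - cos(t(v_w - v_w')))` is non-negative by (C) and vanishes at `0` by (N).) [folklore] -/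
theorem birMom_sum_im_mul_frq_eq_zero (c : Table r) (c₀ : ℝ)
    (hN : c.sum (fun _ a => a) = 0)
    (hC : ∀ φ : W r → ℝ, c₀ * ∑ w, ∑ w', (1 - Real.cos (φ w - φ w')) ≤ (genF c φ).re)
    (v : W r → ℝ) :
    ∑ n ∈ c.support, (c n).im * (∑ w, (n w : ℝ) * v w) = 0 := by
  set g : ℝ → ℝ := fun t => (genF c (fun w => t * v w)).re -
      c₀ * ∑ w, ∑ w', (1 - Real.cos (t * v w - t * v w')) with hg
  have hre0 : (genF c (fun w => (0:ℝ) * v w)).re = 0 := by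
    rw [cvxr_re_genF_ray]
    simp only [zero_mul, Real.cos_zero, Real.sin_zero, mul_one, mul_zero, sub_zero]
    exact cvxr_sum_re_eq_zero hN
  have hg0 : g 0 = 0 := by
    show (genF c (fun w => (0:ℝ) * v w)).re -
      c₀ * ∑ w, ∑ w', (1 - Real.cos ((0:ℝ) * v w - 0 * v w')) = 0
    rw [hre0]
    simp
  have hmin : IsLocalMin g 0 := by
    refine Filter.Eventually.of_forall fun t => ?_
    rw [hg0]
    show 0 ≤ (genF c (fun w => t * v w)).re - c₀ * ∑ w, ∑ w', (1 - Real.cos (t * v w - t * v w'))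
    exact sub_nonneg.mpr (hC _)
  have hderiv : HasDerivAt g ((-∑ n ∈ c.support, (c n).im * ∑ w, (n w : ℝ) * v w) - 0) 0 :=
    (birMom_hasDerivAt_re_genF_ray c v).sub (birMom_hasDerivAt_cosPart c₀ v)
  have h := hmin.hasDerivAt_eq_zero hderiv
  linarith

/-- **Admissible tables have real first moments.**  Under (N) and (C), for every window vertex `w₀` the first
moment `Σ_n n_{w₀} c_n` is a real number. [folklore] -/
theorem birMom_moment_im_eq_zero (c : Table r) (c₀ : ℝ)
    (hN : c.sum (fun _ a => a) = 0)
    (hC : ∀ φ : W r → ℝ, c₀ * ∑ w, ∑ w', (1 - Real.cos (φ w - φ w')) ≤ (genF c φ).re)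
    (w₀ : W r) :
    (c.sum fun n a => ((n w₀ : ℤ) : ℂ) * a).im = 0 := by
  classical
  have h := birMom_sum_im_mul_frq_eq_zero c c₀ hN hC (fun w => if w = w₀ then 1 else 0)
  have hA : ∀ n : Freq r, (∑ w, (n w : ℝ) * (if w = w₀ then (1:ℝ) else 0)) = (n w₀ : ℝ) := by
    intro n
    simp
  simp only [hA] at h
  unfold Finsupp.sum
  rw [Complex.im_sum]
  have e : ∀ n ∈ c.support, (((n w₀ : ℤ) : ℂ) * c n).im = (c n).im * (n w₀ : ℝ) := by
    intro n _
    rw [Complex.mul_im, Complex.intCast_re, Complex.intCast_im]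
    ring
  rw [Finset.sum_congr rfl e]
  exact h

/-! ## Holomorphic (affine) families: admissible complex directions carry no first moment -/

/-- The first-moment functional is additive in the table. [folklore] -/
theorem birMom_moment_add (c d : Table r) (w₀ : W r) :
    ((c + d).sum fun n a => ((n w₀ : ℤ) : ℂ) * a) =
      (c.sum fun n a => ((n w₀ : ℤ) : ℂ) * a) + d.sum (fun n a => ((n w₀ : ℤ) : ℂ) * a) :=
  Finsupp.sum_add_index' (fun n => by simp) (fun n a b => by ring)

/-- The first-moment functional is homogeneous in the table. [folklore] -/
theorem birMom_moment_smul (b : ℂ) (c : Table r) (w₀ : W r) :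
    ((b • c).sum fun n a => ((n w₀ : ℤ) : ℂ) * a) = b * c.sum (fun n a => ((n w₀ : ℤ) : ℂ) * a) := by
  rw [Finsupp.sum_smul_index' (fun n => by simp), Finsupp.mul_sum]
  unfold Finsupp.sum
  refine Finset.sum_congr rfl fun n _ => ?_
  simp only [smul_eq_mul]
  ring

/-- **No admissible holomorphic family moves a first moment.**  If the affine family `c + ζ • d` satisfies (N) and
(C) (with a fixed real `c₀`) for every `ζ` in an OPEN nonempty set of complex parameters, then every first moment
of the direction `d` vanishes: `Σ_n n_{w₀} d_n = 0`.  (The moment of `c + ζ • d` is `m_c + ζ m_d`, real for all `ζ`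
near `ζ₀`, `ζ₀ + ε/2` and `ζ₀ + iε/2`.) [folklore] -/
theorem birMom_dir_moment_eq_zero (c d : Table r) (c₀ : ℝ) {U : Set ℂ} (hU : IsOpen U)
    (hne : U.Nonempty)
    (hN : ∀ ζ ∈ U, (c + ζ • d).sum (fun _ a => a) = 0)
    (hC : ∀ ζ ∈ U, ∀ φ : W r → ℝ,
      c₀ * ∑ w, ∑ w', (1 - Real.cos (φ w - φ w')) ≤ (genF (c + ζ • d) φ).re)
    (w₀ : W r) :
    (d.sum fun n a => ((n w₀ : ℤ) : ℂ) * a) = 0 := by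
  obtain ⟨ζ₀, hζ₀⟩ := hne
  obtain ⟨ε, hε, hball⟩ := Metric.isOpen_iff.mp hU ζ₀ hζ₀
  set mc : ℂ := c.sum fun n a => ((n w₀ : ℤ) : ℂ) * a with hmc
  set md : ℂ := d.sum fun n a => ((n w₀ : ℤ) : ℂ) * a with hmd
  have key : ∀ ζ ∈ U, (mc + ζ * md).im = 0 := by
    intro ζ hζ
    have h := birMom_moment_im_eq_zero (c + ζ • d) c₀ (hN ζ hζ) (hC ζ hζ) w₀
    rwa [birMom_moment_add, birMom_moment_smul] at h
  have h1 : ζ₀ + ((ε / 2 : ℝ) : ℂ) ∈ U := by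
    apply hball
    rw [Metric.mem_ball, dist_eq_norm, add_sub_cancel_left, Complex.norm_real, Real.norm_eq_abs,
      abs_of_pos (by positivity)]
    linarith
  have h2 : ζ₀ + ((ε / 2 : ℝ) : ℂ) * Complex.I ∈ U := by
    apply hball
    rw [Metric.mem_ball, dist_eq_norm, add_sub_cancel_left, norm_mul, Complex.norm_I, mul_one,
      Complex.norm_real, Real.norm_eq_abs, abs_of_pos (by positivity)]
    linarith
  have k0 := key ζ₀ hζ₀
  have k1 := key _ h1
  have k2 := key _ h2
  have e1 : (mc + (ζ₀ + ((ε / 2 : ℝ) : ℂ)) * md).im = (mc + ζ₀ * md).im + ε / 2 * md.im := by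
    simp only [Complex.add_im, Complex.mul_im, Complex.add_re, Complex.ofReal_re, Complex.ofReal_im]
    ring
  have e2 : (mc + (ζ₀ + ((ε / 2 : ℝ) : ℂ) * Complex.I) * md).im =
      (mc + ζ₀ * md).im + ε / 2 * md.re := by
    simp only [Complex.add_im, Complex.mul_im, Complex.add_re, Complex.mul_re, Complex.ofReal_re,
      Complex.ofReal_im, Complex.I_re, Complex.I_im]
    ring
  rw [e1, k0] at k1
  rw [e2, k0] at k2
  have him : md.im = 0 := by
    have hprod : ε / 2 * md.im = 0 := by linarith
    exact (mul_eq_zero.mp hprod).resolve_left (half_pos hε).ne'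
  have hre : md.re = 0 := by
    have hprod : ε / 2 * md.re = 0 := by linarith
    exact (mul_eq_zero.mp hprod).resolve_left (half_pos hε).ne'
  exact Complex.ext hre him

/-- **Registered form (stub `birMom_moment_eq_zero_of_isOpen` of stmt-HubbardSuperconductivity-2080).**  An affine
family of tables `c + ζ • d` that satisfies (N) and (C) on an open nonempty set of complex parameters `ζ` has a
direction `d` with vanishing first moments `Σ_n n_{w₀} d_n = 0` for every window vertex `w₀` — so no admissible
holomorphic family moves the linear Berry coefficient (= leading-order dominant charge sector). [folklore] -/
theorem birMom_moment_eq_zero_of_isOpen : ∀ {r : ℕ} (c d : Table r) (c₀ : ℝ) {U : Set ℂ}, IsOpen U → U.Nonempty → (∀ ζ ∈ U, (c + ζ • d).sum (fun _ a => a) = 0) → (∀ ζ ∈ U, ∀ φ : W r → ℝ, c₀ * ∑ w, ∑ w', (1 - Real.cos (φ w - φ w')) ≤ (genF (c + ζ • d) φ).re) → ∀ w₀ : W r, (d.sum fun n a => ((n w₀ : ℤ) : ℂ) * a) = 0 := by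
  intro r c d c₀ U hU hne hN hC w₀
  exact birMom_dir_moment_eq_zero c d c₀ hU hne hN hC w₀

/-! ## The complex tilt direction is excluded -/

/-- First moment of a single Fourier mode. [folklore] -/
theorem birMom_moment_single (n : Freq r) (a : ℂ) (w₀ : W r) :
    ((Finsupp.single n a).sum fun m b => ((m w₀ : ℤ) : ℂ) * b) = ((n w₀ : ℤ) : ℂ) * a := by
  rw [Finsupp.sum_single_index]
  simp

/-- First moment of a list sum of tables. [folklore] -/
theorem birMom_moment_list_sum (l : List (Table r)) (w₀ : W r) :
    (l.sum.sum fun m b => ((m w₀ : ℤ) : ℂ) * b) =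
      (l.map fun e => e.sum fun m b => ((m w₀ : ℤ) : ℂ) * b).sum := by
  induction l with
  | nil => simp
  | cons e l ih => rw [List.sum_cons, birMom_moment_add, List.map_cons, List.sum_cons, ih]

/-- First moment of the sine table `sin(φ_u - φ_v)`: `-i (δ_u - δ_v)(w₀)`. [folklore] -/
theorem birMom_moment_sinTab (u v w₀ : W 2) :
    ((sinTab u v).sum fun m b => ((m w₀ : ℤ) : ℂ) * b) = -Complex.I * ((dfreq u v w₀ : ℤ) : ℂ) := by
  unfold sinTab
  rw [birMom_moment_add, birMom_moment_single, birMom_moment_single]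
  have e : dfreq v u w₀ = -dfreq u v w₀ := by
    simp [dfreq]
  rw [e]
  push_cast
  ring

/-- The time-odd tilt direction `temporalSinTab = Σ_{4 temporal edges} sin ∂_τφ` has first moment `-i` at the
vertex `(0,0,1)`. [folklore] -/
theorem birMom_moment_temporalSinTab :
    (temporalSinTab.sum fun m b => ((m (vx 0 0 1) : ℤ) : ℂ) * b) = -Complex.I := by
  unfold temporalSinTab temporalEdges
  rw [birMom_moment_list_sum]
  simp only [List.map_cons, List.map_nil, List.sum_cons, List.sum_nil, birMom_moment_sinTab]
  have e1 : dfreq (vx 0 0 1) (vx 0 0 0) (vx 0 0 1) = 1 := by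
    simp [dfreq]
  have e2 : dfreq (vx 0 1 1) (vx 0 1 0) (vx 0 0 1) = 0 := by
    simp [dfreq]
  have e3 : dfreq (vx 1 0 1) (vx 1 0 0) (vx 0 0 1) = 0 := by
    simp [dfreq]
  have e4 : dfreq (vx 1 1 1) (vx 1 1 0) (vx 0 0 1) = 0 := by
    simp [dfreq]
  simp only [e1, e2, e3, e4]
  push_cast
  ring

/-- **No open set of COMPLEX tilts is admissible.**  For every base table `c : Table 2`, every real `c₀` and every
open nonempty `U ⊆ ℂ`, the family `c + ζ • temporalSinTab` violates (N) or (C) at some `ζ ∈ U` — the Berry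
coefficient `ε₂` of the hearts' families is necessarily a REAL parameter, and more generally (by
`birMom_dir_moment_eq_zero`) no admissible holomorphic family changes the linear Berry coefficient, i.e. the
leading-order dominant charge sector. [folklore] -/
theorem birMom_not_admissible_complex_tilt (c : Table 2) (c₀ : ℝ) {U : Set ℂ} (hU : IsOpen U)
    (hne : U.Nonempty) :
    ¬ (∀ ζ ∈ U, (c + ζ • temporalSinTab).sum (fun _ a => a) = 0 ∧
        ∀ φ : W 2 → ℝ, c₀ * ∑ w, ∑ w', (1 - Real.cos (φ w - φ w')) ≤
          (genF (c + ζ • temporalSinTab) φ).re) := by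
  intro h
  have hz := birMom_dir_moment_eq_zero c temporalSinTab c₀ hU hne (fun ζ hζ => (h ζ hζ).1)
    (fun ζ hζ => (h ζ hζ).2) (vx 0 0 1)
  rw [birMom_moment_temporalSinTab] at hz
  exact Complex.I_ne_zero (neg_eq_zero.mp hz)

end AdmissibleMoments

end Summit.HubbardSuperconductivity.HubbardSuperconductivity.Theorems
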